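import Summits.BirchSwinnertonDyer.BirchSwinnertonDyer.Theorems.RamifiedSevenEllipticUnitsKummerIndexCore
import Summits.BirchSwinnertonDyer.Rank1Residual.X11b.ZpLineIndex
import Literature.NumberTheory.EllipticCurves.ZpExtensionZpRankCriterionProofs
import Mathlib.LinearAlgebra.Prod
import HarnessLib

/-!
# K7r crux `EllipticUnitValueSeven` (stmt-BirchSwinnertonDyer-19705), line `rubin-formula`, stub S_dict
# `stub_localMordellWeilDictSeven`: `p`-ADIC INDEX BRICKS for the chart `E(K_𝔭) → ℤ_p × ℤ_p`
# (elementary `ℤ_p`-algebra; cell `bsd-cm`, seat `bsd-cm-k7r-c3` g6; helper file, `--supports` 19705)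

HONEST FRAMING. Elementary facts about `ℤ_p`; nothing about elliptic curves or the crux is asserted,
BSD is not proved by any of this. Companion of `RamifiedSevenEllipticUnitsKummerIndexCore.lean`
(the abstract compact-Kummer index theorem `relIndex_torsion_sup_kummerSpan_eq`), supplying what its
instantiation at `V = ℤ_p × ℤ_p` needs (STUB-PLAN `stub_localMordellWeilDictSeven`, addendum (a), (e)):

* §2 `[ℤ_p : x ℤ_p] = p^{v(x)}` (from the tree's `X11b.LocalIndex.index_span_pow`), and the product index
  `[p^{a₁} ℤ_p × p^{a₂} ℤ_p : x₁ ℤ_p × x₂ ℤ_p] = p^{(v(x₁) − a₁) + (v(x₂) − a₂)}` (`a_i = 0`: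
  `[ℤ_p × ℤ_p : x₁ ℤ_p × x₂ ℤ_p] = p^{v(x₁) + v(x₂)}`);
* §3 `ℤ_p × ℤ_p` is `p`-adically separated and torsion-free (the hypotheses `hsep`, `NoZeroSMulDivisors`
  of the core theorem; separation from the tree's `ZpRankCriterion.eq_zero_of_forall_mem_span`);
* §4 the LEVEL lemma: for `λ : G → ℤ_p` with torsion kernel and image `p^a ℤ_p` on a group with no
  `p`-torsion, a point `X` divisible by `p^n` and not by `p^{n+1}` has `v(λ X) = a + n` — this is how the
  frame data (`P` of level `n` in `E(ℚ_p)`) enter the index; for `E(ℚ_p)` the tree's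
  `X11b.LocalIndex.psi` is such a `λ`, ONTO (`psi_surjective`, `a = 0`) when `E(ℚ_p)[p] = 0`.

References: J. H. Silverman, *AEC* (2009) Prop. VII.6.3; F. Q. Gouvêa, *p-adic Numbers* §3.3 (ideals of
`ℤ_p`); tree files `Rank1Residual/X11b/ZpLineIndex.lean` (cell `b2b-bsdres`),
`Literature/…/ZpExtensionZpRankCriterionProofs.lean`; cell memo `STUB-PLAN-stub_localMordellWeilDictSeven.md`.
-/

set_option linter.dupNamespace false

noncomputable section

open scoped Classical

namespace Summit.BirchSwinnertonDyer.BirchSwinnertonDyer.Theorems.RamifiedSevenEllipticUnits.KummerCore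

variable {p : ℕ} [Fact p.Prime]

/-! ## §2 Indices of principal ideals of `ℤ_p`, and of products -/

open Summit.BirchSwinnertonDyer.Rank1Residual.X11b.LocalIndex (index_span_pow)
open Literature.NumberTheory.EllipticCurves.ZpExtension.ZpRankCriterion (eq_zero_of_forall_mem_span)

/-- `[ℤ_p : x ℤ_p] = p^{v(x)}` for `x ≠ 0` (`x = u p^{v(x)}`, `u` a unit; the tree's `index_span_pow`).
[folklore] -/
theorem index_span_singleton {x : ℤ_[p]} (hx : x ≠ 0) :
    (Ideal.span {x}).toAddSubgroup.index = p ^ x.valuation := by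
  have hux : x = (PadicInt.unitCoeff hx : ℤ_[p]) * (p : ℤ_[p]) ^ x.valuation :=
    PadicInt.unitCoeff_spec hx
  have hspan : Ideal.span {x} = Ideal.span {(p : ℤ_[p]) ^ x.valuation} := by
    conv_lhs => rw [hux]
    exact Ideal.span_singleton_mul_left_unit (PadicInt.unitCoeff hx).isUnit _
  rw [hspan, index_span_pow]

/-- A principal ideal `x ℤ_p`, `v(x) ≥ a`, lies in `p^a ℤ_p`. [folklore] -/
theorem span_singleton_le_span_pow {x : ℤ_[p]} (hx : x ≠ 0) {a : ℕ} (ha : a ≤ x.valuation) :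
    Ideal.span {x} ≤ Ideal.span {(p : ℤ_[p]) ^ a} := by
  rw [Ideal.span_singleton_le_iff_mem]
  exact (PadicInt.mem_span_pow_iff_le_valuation x hx a).2 ha

/-- The additive subgroup of a product of ideals is the product of their additive subgroups. [folklore] -/
theorem toAddSubgroup_prod (I J : Ideal ℤ_[p]) :
    (Submodule.prod I J).toAddSubgroup = I.toAddSubgroup.prod J.toAddSubgroup := by
  ext x
  rw [Submodule.mem_toAddSubgroup, Submodule.mem_prod, AddSubgroup.mem_prod,
    Submodule.mem_toAddSubgroup, Submodule.mem_toAddSubgroup]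

/-- **The product index**: for `x_i ≠ 0` with `v(x_i) = a_i + n_i`,
`[p^{a₁} ℤ_p × p^{a₂} ℤ_p : x₁ ℤ_p × x₂ ℤ_p] = p^{n₁ + n₂}` (relative index of the additive subgroups
of the `ℤ_p`-submodules `Submodule.prod`). For the K7r dictionary: `x₁ = λ(P)`, `x₂ = λ'(P')`, and the
result is `p^{n + n'}`. [folklore] -/
theorem relIndex_prod_span_singleton {x₁ x₂ : ℤ_[p]} (hx₁ : x₁ ≠ 0) (hx₂ : x₂ ≠ 0)
    {a₁ a₂ n₁ n₂ : ℕ} (hv₁ : x₁.valuation = a₁ + n₁) (hv₂ : x₂.valuation = a₂ + n₂) :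
    (Submodule.prod (Ideal.span {x₁}) (Ideal.span {x₂})).toAddSubgroup.relIndex
      (Submodule.prod (Ideal.span {(p : ℤ_[p]) ^ a₁})
        (Ideal.span {(p : ℤ_[p]) ^ a₂})).toAddSubgroup = p ^ (n₁ + n₂) := by
  have hp : p.Prime := Fact.out
  have hle : (Submodule.prod (Ideal.span {x₁}) (Ideal.span {x₂})).toAddSubgroup ≤
      (Submodule.prod (Ideal.span {(p : ℤ_[p]) ^ a₁})
        (Ideal.span {(p : ℤ_[p]) ^ a₂})).toAddSubgroup := by
    rw [toAddSubgroup_prod, toAddSubgroup_prod]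
    exact AddSubgroup.prod_mono
      (Submodule.toAddSubgroup_mono (span_singleton_le_span_pow hx₁ (by omega)))
      (Submodule.toAddSubgroup_mono (span_singleton_le_span_pow hx₂ (by omega)))
  have key := AddSubgroup.relIndex_mul_index hle
  rw [toAddSubgroup_prod, toAddSubgroup_prod, AddSubgroup.index_prod, AddSubgroup.index_prod,
    index_span_pow, index_span_pow, index_span_singleton hx₁, index_span_singleton hx₂, hv₁, hv₂,
    ← toAddSubgroup_prod, ← toAddSubgroup_prod] at key
  have hpos : 0 < p ^ a₁ * p ^ a₂ := mul_pos (pow_pos hp.pos _) (pow_pos hp.pos _)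
  refine Nat.eq_of_mul_eq_mul_right hpos ?_
  rw [key]
  ring

/-- **`[ℤ_p × ℤ_p : x₁ ℤ_p × x₂ ℤ_p] = p^{v(x₁) + v(x₂)}`** for `x_i ≠ 0` (the case `a_i = 0` — the ONTO
charts `psi`). [folklore] -/
theorem index_prod_span_singleton {x₁ x₂ : ℤ_[p]} (hx₁ : x₁ ≠ 0) (hx₂ : x₂ ≠ 0) :
    (Submodule.prod (Ideal.span {x₁}) (Ideal.span {x₂})).toAddSubgroup.index =
      p ^ (x₁.valuation + x₂.valuation) := by
  rw [toAddSubgroup_prod, AddSubgroup.index_prod, index_span_singleton hx₁, index_span_singleton hx₂,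
    pow_add]

/-! ## §3 `ℤ_p × ℤ_p` is `p`-adically separated and torsion-free -/

/-- **`ℤ_p × ℤ_p` is `p`-adically separated**: an element divisible by every `p^k` is `0` (the
hypothesis `hsep` of `relIndex_torsion_sup_kummerSpan_eq`). [folklore] -/
theorem prod_padicInt_separated (v : ℤ_[p] × ℤ_[p])
    (h : ∀ k : ℕ, ∃ w : ℤ_[p] × ℤ_[p], ((p : ℤ_[p]) ^ k) • w = v) : v = 0 := by
  refine Prod.ext (eq_zero_of_forall_mem_span fun k ↦ ?_)
    (eq_zero_of_forall_mem_span fun k ↦ ?_)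
  · obtain ⟨w, hw⟩ := h k
    rw [← hw, Prod.smul_fst, smul_eq_mul]
    exact Ideal.mem_span_singleton.2 (Dvd.intro _ rfl)
  · obtain ⟨w, hw⟩ := h k
    rw [← hw, Prod.smul_snd, smul_eq_mul]
    exact Ideal.mem_span_singleton.2 (Dvd.intro _ rfl)

/-- **`ℤ_p × ℤ_p` is torsion-free as a `ℤ_p`-module** (`ℤ_p` is a domain). [folklore] -/
theorem noZeroSMulDivisors_prod_padicInt : NoZeroSMulDivisors ℤ_[p] (ℤ_[p] × ℤ_[p]) := by
  refine ⟨fun {c v} h ↦ ?_⟩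
  have h1 : c * v.1 = 0 := by rw [← smul_eq_mul, ← Prod.smul_fst, h, Prod.fst_zero]
  have h2 : c * v.2 = 0 := by rw [← smul_eq_mul, ← Prod.smul_snd, h, Prod.snd_zero]
  by_cases hc : c = 0
  · exact Or.inl hc
  · exact Or.inr (Prod.ext ((mul_eq_zero.1 h1).resolve_left hc) ((mul_eq_zero.1 h2).resolve_left hc))

/-! ## §4 The level lemma -/

/-- **LEVEL ⇒ VALUATION.** Let `λ : G → ℤ_p` be additive with kernel exactly the torsion and image
exactly `p^a ℤ_p`, on a group `G` with no `p`-torsion (so torsion is `p`-divisible). If `X` is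
divisible by `p^n` in `G` but not by `p^{n+1}`, then `λ X ≠ 0` and `v(λ X) = a + n`. For `G = E(ℚ_p)`
(AEC VII.6.3) and `X` the image of a generator `P` of `E(ℚ)` this converts the frame datum "level `n`"
into the valuation used by the index computation. [cite: SilvermanAEC2009, Prop. VII.6.3] -/
theorem valuation_eq_of_level {G : Type*} [AddCommGroup G] (lam : G →+ ℤ_[p]) {a : ℕ}
    (hlam : ∀ X : G, lam X = 0 ↔ IsOfFinAddOrder X)
    (hrange : ∀ z : ℤ_[p], (∃ X : G, lam X = z) ↔ z ∈ Ideal.span {(p : ℤ_[p]) ^ a})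
    (hG : ∀ X : G, p • X = 0 → X = 0) {X : G} {n : ℕ}
    (hdiv : ∃ Q : G, p ^ n • Q = X) (hndiv : ∀ Q : G, p ^ (n + 1) • Q ≠ X) :
    lam X ≠ 0 ∧ (lam X).valuation = a + n := by
  have hp : p.Prime := Fact.out
  have hp0 : (p : ℤ_[p]) ≠ 0 := Nat.cast_ne_zero.mpr hp.ne_zero
  -- `X` has infinite order (torsion is `p`-divisible)
  have hX : ¬ IsOfFinAddOrder X := by
    intro hT
    obtain ⟨R, hR⟩ := exists_zsmul_eq_of_isOfFinAddOrder hG hT (n + 1)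
    refine hndiv R ?_
    rw [← hR, ← natCast_zsmul]
    push_cast
    rfl
  have hlamX : lam X ≠ 0 := fun h ↦ hX ((hlam X).1 h)
  refine ⟨hlamX, le_antisymm ?_ ?_⟩
  · -- `v(λ X) ≤ a + n`: otherwise `X` is divisible by `p^{n+1}`
    by_contra hlt
    rw [not_le] at hlt
    have hmem : lam X ∈ Ideal.span {(p : ℤ_[p]) ^ (a + n + 1)} :=
      (PadicInt.mem_span_pow_iff_le_valuation _ hlamX _).2 (by omega)
    obtain ⟨y, hy⟩ := Ideal.mem_span_singleton'.1 hmem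
    -- `p^a y = λ Q'`
    obtain ⟨Q', hQ'⟩ := (hrange ((p : ℤ_[p]) ^ a * y)).2
      (Ideal.mem_span_singleton'.2 ⟨y, mul_comm _ _⟩)
    have hT : IsOfFinAddOrder (X - p ^ (n + 1) • Q') := by
      rw [← hlam, map_sub, map_nsmul, hQ', ← hy, nsmul_eq_mul, sub_eq_zero]
      push_cast
      ring
    obtain ⟨R, hR⟩ := exists_zsmul_eq_of_isOfFinAddOrder hG hT (n + 1)
    refine hndiv (Q' + R) ?_
    rw [smul_add, ← natCast_zsmul R]
    push_cast
    rw [hR, add_sub_cancel]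
  · -- `a + n ≤ v(λ X)`: `λ X = p^n λ Q`, `λ Q ∈ p^a ℤ_p`
    obtain ⟨Q, hQ⟩ := hdiv
    have hQmem : lam Q ∈ Ideal.span {(p : ℤ_[p]) ^ a} := (hrange _).1 ⟨Q, rfl⟩
    have hXmem : lam X ∈ Ideal.span {(p : ℤ_[p]) ^ (a + n)} := by
      rw [← hQ, map_nsmul, nsmul_eq_mul, Nat.cast_pow, pow_add, mul_comm ((p : ℤ_[p]) ^ a)]
      exact Ideal.mul_mem_mul (Ideal.mem_span_singleton_self _) hQmem |> fun h ↦ by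
        rwa [Ideal.span_singleton_mul_span_singleton] at h
    exact (PadicInt.mem_span_pow_iff_le_valuation _ hlamX _).1 hXmem

end Summit.BirchSwinnertonDyer.BirchSwinnertonDyer.Theorems.RamifiedSevenEllipticUnits.KummerCore

end
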